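import Literature.NumberTheory.Rogawski1990.LocalTransfer
import HarnessLib

/-!
# Transversal sums: `∑ᶠ` over conjugacy classes against a transfer factor ∕ a stable-conjugacy relation = a finite sum over an explicit family of representatives
# (Rogawski 1990 §4.1 (4.1.1) p. 39, §4.3 (4.3.1) p. 43; the finite-sum regroupings of §12.5 p. 183 ∕ Lemma 12.5.1)

Topic `NumberTheory/Rogawski1990`; namespace `Literature.NumberTheory.Rogawski1990`.  THEOREMS ONLY (no definition, no instance, no notation, no named fact, no `sorry`);
generic over abstract groups.  Cell `pub/hodgecm-mathlib`, crux H413 = `stmt-HodgeConjecture-24833` (lane `--supports`, count-neutral); seat F0P3a-p02 (g24); ROAD «UP-TR»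
(holder F0P3-p02 (g23), architecture v2 a950f43e §A) — the two regroupings used at (A-4) (the `G`-side bracket `∑ᶠ_c Δ‴(s, out c) Φ_G(c, f)` as a sum over the EMB-FAMILY
transversal of (N2b′)) and at (A-5) (`Φ^st_H(s, fH) = Σ_{φ ∈ Tw} Φ_H(⟦φ s⟧, fH)` over the TWIST family of (H6a′)), typed ONCE over abstract groups so that the consumers bind them by
`exact` with the exhaustion ∕ injectivity clauses of those bricks as hypotheses.

* §1 `G`-side, transfer factor `T : TransferFactorData A B R` (★ `LocalTransfer`: `Δ(a, ·)` vanishes off `R a ·` and is a class function in each variable): for a finite family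
  `b : ι → B` over `s : Finset ι` which EXHAUSTS the matches of `a` up to conjugacy (`∀ k, R a k → ∃ i ∈ s, IsConj (b i) k`) and is INJECTIVE up to conjugacy,
  **`finsum_delta_mul_classOrbitalIntegral_eq_sum_of_family`**: `∑ᶠ c, Δ(a, out c) · Φ(c, f) = Σ_{i ∈ s} Δ(a, b i) · Φ(⟦b i⟧, f)` (the multi-class twin of ★
  `finsum_delta_mul_classOrbitalIntegral_eq_of_unique`); element-`Finset` form `…_eq_sum_of_transversal`.
* §2 `H`-side, a «stable conjugacy» relation `st` stable under conjugating its second argument: for a finite family `φ : ι → A` over `s` of `st`-partners of `a`, exhausting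
  `{k | st a k}` up to conjugacy and injective up to conjugacy, **`stableOrbitalIntegralRel_eq_sum_of_family`**: `Φ^st(a, f) = Σ_{i ∈ s} Φ(⟦φ i⟧, f)` (the family twin of ★
  `stableOrbitalIntegralRel_eq_sum` ∕ ★ `stableOrbitalIntegralRel_eq_add_of_two_classes`); element-`Finset` form `…_eq_sum_of_transversal`; and the class-set identity
  `setOf_st_out_eq_image` behind it.
HONEST LABEL: count-neutral finite bookkeeping; proves no printed statement; HC_CM is proved only modulo the printed citations (2 remaining named inputs: hLiu418 =
`stmt-HodgeConjecture-24832`, h413 = `stmt-HodgeConjecture-24833`) until rung 0 closes.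

## References
* [Rogawski1990] J. D. Rogawski, *Automorphic Representations of Unitary Groups in Three Variables*, Ann. of Math. Stud. 123 (1990), §4.1 (4.1.1) p. 39, §4.3 (4.3.1)–(4.3.2) p. 43,
  §12.5 p. 183 (Lemma 12.5.1).
-/

set_option autoImplicit false

noncomputable section

namespace Literature.NumberTheory.Rogawski1990

open Literature.NumberTheory.Automorphic

/-! ## §1 The `G`-side: `∑ᶠ_c Δ(a, out c) Φ(c, f)` over a transversal of the matches of `a` -/

section Delta

variable {A B ι : Type*} [Group A] [Group B] [∀ b : B, MeasurableSpace (B ⧸ Subgroup.centralizer ({b} : Set B))] {R : A → B → Prop}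

/-- **`∑ᶠ_c Δ(a, out c) · Φ(c, f)` IS A FINITE SUM OVER ANY TRANSVERSAL FAMILY OF THE MATCHES OF `a`.**  For a transfer factor `T` supported on `R` and conjugation-invariant in
the second variable (★ `TransferFactorData`), any orbital measure family `mG`, any `f`, and a finite family `b : ι → B` over `s` such that every `k` with `R a k` is conjugate to
some `b i` (`i ∈ s`) and distinct indices give non-conjugate elements: `∑ᶠ c, Δ(a, out c) Φ(c, f) = Σ_{i ∈ s} Δ(a, b i) Φ(⟦b i⟧, f)` — the support of the summand lies in
`{⟦b i⟧}` (`Δ(a, out c) ≠ 0` forces `R a (out c)`), `i ↦ ⟦b i⟧` is injective on `s`, and `Δ(a, out ⟦b i⟧) = Δ(a, b i)` by conjugation invariance.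
[cite: Rogawski1990, §4.3 (4.3.1)–(4.3.2) p. 43; §12.5 p. 183] -/
theorem finsum_delta_mul_classOrbitalIntegral_eq_sum_of_family (T : TransferFactorData A B R) (mG : OrbitalMeasureFamily B) (f : B → ℂ) (a : A)
    (s : Finset ι) (b : ι → B) (hexh : ∀ k : B, R a k → ∃ i ∈ s, IsConj (b i) k) (hinj : ∀ i ∈ s, ∀ j ∈ s, i ≠ j → ¬ IsConj (b i) (b j)) :
    ∑ᶠ c : ConjClasses B, T.Δ a (Quotient.out c) * classOrbitalIntegral mG f c =
      ∑ i ∈ s, T.Δ a (b i) * classOrbitalIntegral mG f (ConjClasses.mk (b i)) := by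
  classical
  have hsupp : (Function.support fun c : ConjClasses B => T.Δ a (Quotient.out c) * classOrbitalIntegral mG f c) ⊆
      ↑(s.image fun i => ConjClasses.mk (b i)) := by
    intro c hc
    rw [Function.mem_support] at hc
    have hΔ : T.Δ a (Quotient.out c) ≠ 0 := fun h => hc (by rw [h, zero_mul])
    have hrel : R a (Quotient.out c) := by
      by_contra h
      exact hΔ (T.eq_zero_of_not_rel _ _ h)
    obtain ⟨i, hi, hconj⟩ := hexh _ hrel
    rw [Finset.coe_image]
    exact ⟨i, Finset.mem_coe.2 hi, (ConjClasses.mk_eq_mk_iff_isConj.2 hconj).trans (Quotient.out_eq c)⟩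
  rw [finsum_eq_sum_of_support_subset _ hsupp, Finset.sum_image]
  · refine Finset.sum_congr rfl fun i _ => ?_
    -- `Δ(a, out ⟦b i⟧) = Δ(a, b i)`: `out ⟦b i⟧ = y (b i) y⁻¹`
    obtain ⟨y, hy⟩ := isConj_iff.1 (ConjClasses.mk_eq_mk_iff_isConj.1 (Quotient.out_eq (ConjClasses.mk (b i))).symm)
    rw [← hy, T.conj_right]
  · intro i hi j hj hij
    by_contra hne
    exact hinj i hi j hj hne (ConjClasses.mk_eq_mk_iff_isConj.1 hij)

/-- **Element-`Finset` form**: for a finite TRANSVERSAL `S ⊆ B` of the matches of `a` (every `k` with `R a k` conjugate to a member; members pairwise non-conjugate),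
`∑ᶠ c, Δ(a, out c) Φ(c, f) = Σ_{b ∈ S} Δ(a, b) Φ(⟦b⟧, f)`. [cite: Rogawski1990, §4.3 (4.3.1)–(4.3.2) p. 43; §12.5 p. 183] -/
theorem finsum_delta_mul_classOrbitalIntegral_eq_sum_of_transversal (T : TransferFactorData A B R) (mG : OrbitalMeasureFamily B) (f : B → ℂ) (a : A)
    (S : Finset B) (hexh : ∀ k : B, R a k → ∃ b ∈ S, IsConj b k) (hinj : ∀ b ∈ S, ∀ b' ∈ S, b ≠ b' → ¬ IsConj b b') :
    ∑ᶠ c : ConjClasses B, T.Δ a (Quotient.out c) * classOrbitalIntegral mG f c =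
      ∑ b ∈ S, T.Δ a b * classOrbitalIntegral mG f (ConjClasses.mk b) :=
  finsum_delta_mul_classOrbitalIntegral_eq_sum_of_family T mG f a S id hexh hinj

/-- **Vanishing form**: if NO `k` matches `a` (`∀ k, ¬ R a k`) then `∑ᶠ c, Δ(a, out c) Φ(c, f) = 0` (empty transversal). [cite: Rogawski1990, §4.3 (4.3.1) p. 43] -/
theorem finsum_delta_mul_classOrbitalIntegral_eq_zero_of_forall_not (T : TransferFactorData A B R) (mG : OrbitalMeasureFamily B) (f : B → ℂ) (a : A)
    (hno : ∀ k : B, ¬ R a k) :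
    ∑ᶠ c : ConjClasses B, T.Δ a (Quotient.out c) * classOrbitalIntegral mG f c = 0 := by
  rw [finsum_delta_mul_classOrbitalIntegral_eq_sum_of_transversal T mG f a ∅ (fun k hk => (hno k hk).elim) (fun b hb => (Finset.notMem_empty b hb).elim),
    Finset.sum_empty]

end Delta

/-! ## §2 The `H`-side: `Φ^st(a, f)` over a transversal family of the `st`-class of `a` -/

section Stable

variable {A ι : Type*} [Group A]

/-- **The class set of `Φ^st(a, ·)` is the image of a transversal family**: if `st a` is stable under conjugating its argument, every `φ i` (`i ∈ s`) is an `st`-partner of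
`a`, and every `st`-partner of `a` is conjugate to some `φ i`, then `{c | st a (out c)} = (fun i => ⟦φ i⟧) '' s`. [cite: Rogawski1990, §4.1 (4.1.1) p. 39] -/
theorem setOf_st_out_eq_image (st : A → A → Prop) (a : A) (s : Finset ι) (φ : ι → A) (hst : ∀ i ∈ s, st a (φ i))
    (hconj : ∀ k k' : A, IsConj k k' → st a k → st a k') (hexh : ∀ k : A, st a k → ∃ i ∈ s, IsConj (φ i) k) :
    {c : ConjClasses A | st a (Quotient.out c)} = (fun i => ConjClasses.mk (φ i)) '' (s : Set ι) := by
  ext c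
  constructor
  · intro hc
    obtain ⟨i, hi, hconj'⟩ := hexh _ hc
    exact ⟨i, Finset.mem_coe.2 hi, (ConjClasses.mk_eq_mk_iff_isConj.2 hconj').trans (Quotient.out_eq c)⟩
  · rintro ⟨i, hi, rfl⟩
    have h : IsConj (φ i) (Quotient.out (ConjClasses.mk (φ i))) :=
      ConjClasses.mk_eq_mk_iff_isConj.1 (Quotient.out_eq (ConjClasses.mk (φ i))).symm
    exact hconj _ _ h (hst i (Finset.mem_coe.1 hi))

/-- **`Φ^st(a, f)` IS A FINITE SUM OVER ANY TRANSVERSAL FAMILY OF THE `st`-CLASS OF `a`.**  For a «stable conjugacy» relation `st` with `st a` stable under conjugation of its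
argument, any orbital measure family, any `f`, and a finite family `φ : ι → A` over `s` of `st`-partners of `a` exhausting `{k | st a k}` up to conjugacy and injective up to
conjugacy: `Φ^st(a, f) = Σ_{i ∈ s} Φ(⟦φ i⟧, f)` (★ `stableOrbitalIntegralRel` is the `finsum` over `{c | st a (out c)}`, which is `{⟦φ i⟧ | i ∈ s}` with `i ↦ ⟦φ i⟧` injective on
`s`). [cite: Rogawski1990, §4.1 (4.1.1) p. 39; §12.5 p. 183] -/
theorem stableOrbitalIntegralRel_eq_sum_of_family [∀ a : A, MeasurableSpace (A ⧸ Subgroup.centralizer ({a} : Set A))]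
    (st : A → A → Prop) (mH : OrbitalMeasureFamily A) (f : A → ℂ) (a : A) (s : Finset ι) (φ : ι → A)
    (hst : ∀ i ∈ s, st a (φ i)) (hconj : ∀ k k' : A, IsConj k k' → st a k → st a k') (hexh : ∀ k : A, st a k → ∃ i ∈ s, IsConj (φ i) k)
    (hinj : ∀ i ∈ s, ∀ j ∈ s, i ≠ j → ¬ IsConj (φ i) (φ j)) :
    stableOrbitalIntegralRel st mH f a = ∑ i ∈ s, classOrbitalIntegral mH f (ConjClasses.mk (φ i)) := by
  classical
  have hinj' : Set.InjOn (fun i => ConjClasses.mk (φ i)) (s : Set ι) := by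
    intro i hi j hj hij
    by_contra hne
    exact hinj i (Finset.mem_coe.1 hi) j (Finset.mem_coe.1 hj) hne (ConjClasses.mk_eq_mk_iff_isConj.1 hij)
  rw [stableOrbitalIntegralRel_def, setOf_st_out_eq_image st a s φ hst hconj hexh, finsum_mem_image hinj', finsum_mem_coe_finset]

/-- **Element-`Finset` form**: for a finite TRANSVERSAL `S ⊆ A` of the `st`-class of `a` (members are `st`-partners of `a`, exhaust it up to conjugacy, pairwise non-conjugate),
`Φ^st(a, f) = Σ_{k ∈ S} Φ(⟦k⟧, f)`. [cite: Rogawski1990, §4.1 (4.1.1) p. 39; §12.5 p. 183] -/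
theorem stableOrbitalIntegralRel_eq_sum_of_transversal [∀ a : A, MeasurableSpace (A ⧸ Subgroup.centralizer ({a} : Set A))]
    (st : A → A → Prop) (mH : OrbitalMeasureFamily A) (f : A → ℂ) (a : A) (S : Finset A)
    (hst : ∀ k ∈ S, st a k) (hconj : ∀ k k' : A, IsConj k k' → st a k → st a k') (hexh : ∀ k : A, st a k → ∃ k₀ ∈ S, IsConj k₀ k)
    (hinj : ∀ k ∈ S, ∀ k' ∈ S, k ≠ k' → ¬ IsConj k k') :
    stableOrbitalIntegralRel st mH f a = ∑ k ∈ S, classOrbitalIntegral mH f (ConjClasses.mk k) :=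
  stableOrbitalIntegralRel_eq_sum_of_family st mH f a S id hst hconj hexh hinj

/-- **The classes in the sum are counted exactly**: under the same hypotheses `{c | st a (out c)}` is finite with `ncard = s.card`. [cite: Rogawski1990, §4.1 (4.1.1) p. 39] -/
theorem ncard_setOf_st_out_eq_card (st : A → A → Prop) (a : A) (s : Finset ι) (φ : ι → A) (hst : ∀ i ∈ s, st a (φ i))
    (hconj : ∀ k k' : A, IsConj k k' → st a k → st a k') (hexh : ∀ k : A, st a k → ∃ i ∈ s, IsConj (φ i) k)
    (hinj : ∀ i ∈ s, ∀ j ∈ s, i ≠ j → ¬ IsConj (φ i) (φ j)) :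
    {c : ConjClasses A | st a (Quotient.out c)}.ncard = s.card := by
  classical
  have hinj' : Set.InjOn (fun i => ConjClasses.mk (φ i)) (s : Set ι) := by
    intro i hi j hj hij
    by_contra hne
    exact hinj i (Finset.mem_coe.1 hi) j (Finset.mem_coe.1 hj) hne (ConjClasses.mk_eq_mk_iff_isConj.1 hij)
  rw [setOf_st_out_eq_image st a s φ hst hconj hexh, hinj'.ncard_image, Set.ncard_coe_finset]

end Stable

end Literature.NumberTheory.Rogawski1990
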